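import Summits.ResolutionOfSingularities.ResolutionOfSingularities.Theorems.WildConesClassicalRegimesStubMuDropCharTwoOrdPDict
import Summits.ResolutionOfSingularities.ResolutionOfSingularities.Theorems.WildConesClassicalRegimesStubMuDropCharTwoOrdPEmbed
import Summits.ResolutionOfSingularities.ResolutionOfSingularities.Theorems.WildConesClassicalRegimesStubMuDropCharTwoOrdPInduction

/-!
# Crux `IsolatedJacobianDrop` (stmt-ResolutionOfSingularities-18946, route `JacobianBudget`) —
# THE WHOLE CHARACTERISTIC-TWO CASE of the budget

The crux `Theses.JacobianBudget.IsolatedJacobianDrop` (THE BUDGET): along the point-blow-up dynamics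
of a height-one atom `z^p = a(u₁,…,uₙ)` over a perfect field of characteristic `p`, whenever two
consecutive states are isolated of multiplicity `p`, the Milnor-type colength
`μ = dim_κ κ⟦u⟧/(∂₁a,…,∂ₙa)` drops by at least `Δ_n(p) = ((p-1)ⁿ(p+1) + 1 - 2((n+1) mod 2))/p`.
Its one-step form over the named calculus `clean/bl/dv/tr/step/run/ser/pd/jac/Isol/MultP/mu` of
`Theorems/WildConesClassicalRegimesDefs.lean` is `JacobianBudget.SingleStepDrop`
(`Theorems/JacobianBudgetDefs.lean`, decrement `JacobianBudget.Δ p n`, definitional bridge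
`isolatedJacobianDrop_of_singleStepDrop`); this file states its results over the `WildCones` names
with the decrement written out, `((p - 1) ^ n * (p + 1) + 1 - 2 * ((n + 1) % 2)) / p` — VERBATIM the
crux's `let Δ` and the body of `JacobianBudget.Δ`, so that they are consumed by `exact` — and imports
neither a route thesis file nor `JacobianBudgetDefs` (chain W4.1 import discipline: only a leaf that
closes an item by name imports a `Theses` module).

At `p = 2` the decrement is `Δ_n(2) = 1` for `n` even and `Δ_n(2) = 2` for `n` odd, and BOTH are
supplied by the characteristic-two Milnor-drop kit landed for the sibling crux
`WildCones.ClassicalRegimes` (files `Theorems/WildConesClassicalRegimesStubMuDropCharTwoOrdP*.lean`):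

* `n` even — the one-step drop `μ(step i τ c) < μ(c)` is
  `MuDropCharTwoOrdP.muDrop_of_seriesDrop (MuDropCharTwoOrdP.series_drop n)` (dictionary + formal
  drop, every `n`, every chart, no "cleaned order exactly two" hypothesis);
* `n` odd — NEW here, but from the same kit: the hyperbolic-pair descent
  `MuDropCharTwoOrdP.descent_package` (`n ↦ n - 2`) preserves BOTH Milnor algebras up to
  `κ`-algebra isomorphism, a state without a square-free quadratic monomial has no isolated
  successor in `n ≥ 3` variables (`MuDropCharTwoOrdP.caseA_not_finite`), and in ONE variable the
  Milnor number of the formal pair `X² G = a` drops by EXACTLY two (`curve_drop_eq`, the computation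
  of `MuDropCharTwoOrdP.curve_drop` kept as an equality). Hence for odd `n` the one-step drop at an
  isolated double step is EXACTLY `2 = Δ_n(2)` (`formal_drop_odd`, `mu_step_add_two_eq`) — the
  exact law the item's censuses observed (refuter kit j023960: `Δμ ≡ -2` at `(p,n) = (2,3)` over
  482k isolated double steps; census j256299: minimum margin `2` at `n = 3, 5`).

Main statements: `singleStepDrop_two` / `singleStepDrop_of_eq_two` (the one-step budget in
characteristic two, every `n`, every field of characteristic two — perfectness is not used) and
`isolatedJacobianDrop_charTwo` (the crux's displayed statement VERBATIM, `let`-block included, under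
the one extra hypothesis `p = 2`). After this file the budget is an odd-characteristic problem (the
by-name reduction `IsolatedJacobianDrop ⇐ one-step drop at odd primes` is the leaf
`Theorems/JacobianBudgetIsolatedJacobianDropOddReduction.lean`).

This is a BANK item of chain W4.1 (campaign res-hironaka, rung L, slot W4.1; `L/w41/CHAIN.md` v2 §D
row stub-3), explicitly not summit progress: the crux's only use in the route's `closes` is the target
`IsolatedForcedTermination`, already a theorem (`Theorems.WildCones.IsolatedForcedTermination_proof`).
Everything here is OURS; it replaces the role of no printed item and is NOT a statement of Hironaka's
manuscript. Imports: the `MuDropCharTwoOrdP` kit only.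

Source of the one non-trivial input (used inside `descent_package`): G.-M. Greuel, G. Pfister,
*The splitting lemma in any characteristic*, J. Algebra 689 (2026) = arXiv:2507.17078, Thm. 3.5 /
Cor. 3.7. Everything in this file is bookkeeping over landed lemmas. [folklore]
-/

noncomputable section

-- single-problem summit: the doubled namespace component `ResolutionOfSingularities` is forced
set_option linter.dupNamespace false

open scoped BigOperators Classical

open MvPowerSeries IsLocalRing

open Literature.AlgebraicGeometry.Resolution

open Summit.ResolutionOfSingularities.ResolutionOfSingularities.Theorems.WildCones
  (clean bl ord dv tr step run ser pd jac Isol MultP mu)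
open Summit.ResolutionOfSingularities.ResolutionOfSingularities.Theorems.WildCones.MuDropCharTwoOrdP

namespace Summit.ResolutionOfSingularities.ResolutionOfSingularities.Theorems.JacobianBudget

namespace CharTwo

variable {κ : Type} [Field κ]

/-! ## The curve leaf as an EXACT law: in one variable the Milnor number drops by exactly two -/

/-- **The curve leaf, exact form.** In one variable and characteristic two, if `X² G = a` and the
Milnor algebra `κ⟦X⟧/(∂G)` is finite, then `dim_κ κ⟦X⟧/(∂G) + 2 = dim_κ κ⟦X⟧/(∂a)`: `∂a = X² ∂G`,
`∂G = X^ν · unit`, and `dim_κ κ⟦X⟧/(X^k) = k`. Verbatim the computation of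
`MuDropCharTwoOrdP.curve_drop` (which records only `<`). [folklore] -/
theorem curve_drop_eq [CharP κ 2] (i : Fin 1) (τ : Fin 1 → κ) {a G : MvPowerSeries (Fin 1) κ}
    (hG : X i ^ 2 * G = subst (fun s => if s = i then (X i : MvPowerSeries (Fin 1) κ)
      else X i * (X s + C (τ s))) a)
    (hfin : Module.Finite κ (MvPowerSeries (Fin 1) κ ⧸
      Ideal.span (Set.range fun s => MvPowerSeries.pderiv s G))) :
    Module.finrank κ (MvPowerSeries (Fin 1) κ ⧸
        Ideal.span (Set.range fun s => MvPowerSeries.pderiv s G)) + 2 =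
      Module.finrank κ (MvPowerSeries (Fin 1) κ ⧸
        Ideal.span (Set.range fun s => MvPowerSeries.pderiv s a)) := by
  have hi : i = 0 := Subsingleton.elim _ _
  subst hi
  have hφ : (fun s => if s = (0 : Fin 1) then (X 0 : MvPowerSeries (Fin 1) κ)
      else X 0 * (X s + C (τ s))) = X := by
    funext s; rw [Subsingleton.elim s 0, if_pos rfl]
  rw [hφ, subst_self, id] at hG
  have hrange : ∀ f : MvPowerSeries (Fin 1) κ, (Set.range fun s => MvPowerSeries.pderiv s f) =
      {MvPowerSeries.pderiv 0 f} := by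
    intro f
    ext x
    simp only [Set.mem_range, Set.mem_singleton_iff]
    exact ⟨fun ⟨s, hs⟩ => by rw [← hs, Subsingleton.elim s 0], fun h => ⟨0, h.symm⟩⟩
  rw [hrange, hrange] at *
  have hda : MvPowerSeries.pderiv 0 a = X 0 ^ 2 * MvPowerSeries.pderiv 0 G := by
    rw [← hG, pderiv_X_sq_mul]
  -- `∂G ≠ 0` by finiteness
  have hg : MvPowerSeries.pderiv 0 G ≠ 0 := by
    intro h0
    rw [h0, Ideal.span_singleton_zero] at hfin
    refine not_finite_quot_span (n := 1) (κ := κ) ∅ (by simp) (by simp) ?_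
    rwa [Finset.coe_empty, Ideal.span_empty]
  obtain ⟨u, hu, hgu⟩ := exists_eq_X_pow_mul_unit hg
  set ν := (MvPowerSeries.pderiv 0 G).order.toNat with hν
  have h1 : Ideal.span {MvPowerSeries.pderiv 0 G} =
      Ideal.span {(X 0 : MvPowerSeries (Fin 1) κ) ^ ν} := by
    conv_lhs => rw [hgu]
    exact Ideal.span_singleton_mul_right_unit hu _
  have h2 : Ideal.span {MvPowerSeries.pderiv 0 a} =
      Ideal.span {(X 0 : MvPowerSeries (Fin 1) κ) ^ (ν + 2)} := by
    rw [hda, hgu, ← mul_assoc, ← pow_add, add_comm]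
    exact Ideal.span_singleton_mul_right_unit hu _
  rw [h1, h2, (finrank_quot_X_pow ν).2, (finrank_quot_X_pow (ν + 2)).2]

/-! ## The formal EXACT law for an odd number of variables -/

/-- **The formal drop for odd `n` is exactly two** (characteristic two). For `a` of order `≥ 2` and
its strict transform `G` without linear terms (`X_i² G = a∘Φ_{i,τ}`), both Milnor algebras finite,
and `n` ODD: `dim_κ κ⟦X⟧/(∂G) + 2 = dim_κ κ⟦X⟧/(∂a)`. Strong induction on `n` in steps of two:
`n = 1` is `curve_drop_eq`; for `n ≥ 3` a square-free quadratic monomial of `a` away from the chart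
index (`exists_pair_ne`) lets `descent_package` pass to `n - 2` (odd) variables with BOTH colengths
unchanged, and without such a monomial the successor is not isolated (`caseA_not_finite`). The
surface leaf is never reached. [cite: GreuelPfister2026, Thm 3.5 and Cor 3.7] -/
theorem formal_drop_odd [CharP κ 2] :
    ∀ (n : ℕ), Odd n → ∀ (i : Fin n) (τ : Fin n → κ) (a G : MvPowerSeries (Fin n) κ),
      2 ≤ a.order → (∀ s, coeff (Finsupp.single s 1) G = 0) →
      X i ^ 2 * G = subst (fun s => if s = i then (X i : MvPowerSeries (Fin n) κ)
        else X i * (X s + C (τ s))) a →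
      Module.Finite κ (MvPowerSeries (Fin n) κ ⧸
        Ideal.span (Set.range fun s => MvPowerSeries.pderiv s a)) →
      Module.Finite κ (MvPowerSeries (Fin n) κ ⧸
        Ideal.span (Set.range fun s => MvPowerSeries.pderiv s G)) →
      Module.finrank κ (MvPowerSeries (Fin n) κ ⧸
          Ideal.span (Set.range fun s => MvPowerSeries.pderiv s G)) + 2 =
        Module.finrank κ (MvPowerSeries (Fin n) κ ⧸
          Ideal.span (Set.range fun s => MvPowerSeries.pderiv s a)) := by
  intro n
  induction n using Nat.strong_induction_on with
  | _ n IHn =>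
  intro hodd i τ a G ha hG0 hG hfa hfG
  rcases Nat.lt_or_ge n 3 with hlt | hge
  · obtain ⟨k, hk⟩ := hodd
    have h1 : n = 1 := by omega
    subst h1
    exact curve_drop_eq i τ hG hfG
  · by_cases hpair : ∃ j l : Fin n, j ≠ l ∧ coeff (Finsupp.single j 1 + Finsupp.single l 1) a ≠ 0
    · obtain ⟨j, l, hjl, hj, hl, hq⟩ := exists_pair_ne i τ ha hG hG0 hpair
      obtain ⟨i', τ', a', G', -, ha', hG0', hG', hfa', hfG', hμa, hμG⟩ :=
        descent_package i τ ha hG0 hG hjl hj hl hq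
      rw [← hμa, ← hμG]
      have hodd' : Odd (n - 2) := by
        obtain ⟨k, hk⟩ := hodd
        exact ⟨k - 1, by omega⟩
      exact IHn (n - 2) (by omega) hodd' i' τ' a' G' ha' hG0' hG' (hfa' hfa) (hfG' hfG)
    · push Not at hpair
      exact absurd hfG (caseA_not_finite hge i τ ha hG hG0 fun j l hjl => hpair j l hjl)

/-- **The EXACT one-step law in characteristic two, odd `n`**, over the route's calculus: if a state
`c` and its successor `step i τ c` are both isolated of multiplicity two and `n` is odd, then
`μ(step i τ c) + 2 = μ(c)`. The char-two dictionary `MuDropCharTwoOrdP.dictCharTwo` (`jac c = (∂a)`,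
`jac (step i τ c) = (∂G)` for the formal pair `a = ser c`, `G` = the uncleaned transform) applied to
`formal_drop_odd`. [folklore] -/
theorem mu_step_add_two_eq [CharP κ 2] {n : ℕ} (hn : Odd n) (c : (Fin n → ℕ) → κ) (i : Fin n)
    (τ : Fin n → κ) (hI : Isol 2 n κ c) (hM : MultP 2 n κ c) (hI' : Isol 2 n κ (step 2 n κ i τ c))
    (hM' : MultP 2 n κ (step 2 n κ i τ c)) :
    mu 2 n κ (step 2 n κ i τ c) + 2 = mu 2 n κ c := by
  obtain ⟨G, ha, hG0, hG, hj, hj'⟩ := dictCharTwo c i τ hM hM'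
  change Module.Finite κ (MvPowerSeries (Fin n) κ ⧸ jac 2 n κ c) at hI
  change Module.Finite κ (MvPowerSeries (Fin n) κ ⧸ jac 2 n κ (step 2 n κ i τ c)) at hI'
  change Module.finrank κ (MvPowerSeries (Fin n) κ ⧸ jac 2 n κ (step 2 n κ i τ c)) + 2 =
    Module.finrank κ (MvPowerSeries (Fin n) κ ⧸ jac 2 n κ c)
  rw [hj] at hI ⊢
  rw [hj'] at hI' ⊢
  exact formal_drop_odd n hn i τ _ G ha hG0 hG hI hI'

/-! ## The decrement at `p = 2` (the crux's `let Δ`, written out) -/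

/-- `Δ_n(2) = 1` for `n` even (the crux's decrement `((p - 1) ^ n * (p + 1) + 1 - 2 * ((n + 1) % 2)) / p`
at `p = 2`). [folklore] -/
theorem decrement_two_of_even {n : ℕ} (hn : Even n) :
    ((2 - 1) ^ n * (2 + 1) + 1 - 2 * ((n + 1) % 2)) / 2 = 1 := by
  obtain ⟨k, hk⟩ := hn
  have h : (n + 1) % 2 = 1 := by omega
  rw [h]
  norm_num

/-- `Δ_n(2) = 2` for `n` odd. [folklore] -/
theorem decrement_two_of_odd {n : ℕ} (hn : Odd n) :
    ((2 - 1) ^ n * (2 + 1) + 1 - 2 * ((n + 1) % 2)) / 2 = 2 := by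
  obtain ⟨k, hk⟩ := hn
  have h : (n + 1) % 2 = 0 := by omega
  rw [h]
  norm_num

/-! ## The one-step budget in characteristic two, every `n` -/

/-- **THE ONE-STEP BUDGET IN CHARACTERISTIC TWO** (every `n`, every field of characteristic two):
if a state `c` and its successor `step i τ c` are both isolated of multiplicity two, then
`μ(step i τ c) + Δ_n(2) ≤ μ(c)`, the decrement written out as in the crux. Even `n` (`Δ = 1`): the
landed one-step drop `muDrop_of_seriesDrop (series_drop n)`; odd `n` (`Δ = 2`): the exact law
`mu_step_add_two_eq`. [cite: GreuelPfister2026, Thm 3.5 and Cor 3.7] -/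
theorem singleStepDrop_two [CharP κ 2] {n : ℕ} (c : (Fin n → ℕ) → κ) (i : Fin n)
    (τ : Fin n → κ) (hI : Isol 2 n κ c) (hM : MultP 2 n κ c) (hI' : Isol 2 n κ (step 2 n κ i τ c))
    (hM' : MultP 2 n κ (step 2 n κ i τ c)) :
    mu 2 n κ (step 2 n κ i τ c) + ((2 - 1) ^ n * (2 + 1) + 1 - 2 * ((n + 1) % 2)) / 2 ≤
      mu 2 n κ c := by
  rcases Nat.even_or_odd n with he | ho
  · rw [decrement_two_of_even he]
    exact Nat.succ_le_of_lt (muDrop_of_seriesDrop (series_drop n) c i τ hI hM hI' hM')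
  · rw [decrement_two_of_odd ho, mu_step_add_two_eq ho c i τ hI hM hI' hM']

/-- **`SingleStepDrop` at the prime `2`** — the binder shape of `JacobianBudget.SingleStepDrop` with
`p = 2` as a hypothesis and the decrement `JacobianBudget.Δ p n` written out (its body verbatim, so
`exact` consumes it where `Δ p n` is displayed), for the eventual by-cases assembly of the crux.
[folklore] -/
theorem singleStepDrop_of_eq_two (p : ℕ) (hp : p = 2) (n : ℕ) (κ : Type) [Field κ] [CharP κ p]
    (c : (Fin n → ℕ) → κ) (i : Fin n) (τ : Fin n → κ) (hI : Isol p n κ c) (hM : MultP p n κ c)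
    (hI' : Isol p n κ (step p n κ i τ c)) (hM' : MultP p n κ (step p n κ i τ c)) :
    mu p n κ (step p n κ i τ c) + ((p - 1) ^ n * (p + 1) + 1 - 2 * ((n + 1) % 2)) / p ≤
      mu p n κ c := by
  subst hp
  exact singleStepDrop_two c i τ hI hM hI' hM'

end CharTwo

/-! ## The crux at `p = 2` -/

/-- **THE CRUX `IsolatedJacobianDrop` IN CHARACTERISTIC TWO** — the crux's displayed statement
VERBATIM (its fourteen `let`s included) under the one extra hypothesis `p = 2`: for every `n ≥ 1`,
every perfect field `κ` of characteristic `2`, every start `c₀`, chart word `i` and translation word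
`t`, if the states at stages `m` and `m + 1` are both isolated of multiplicity `2` then
`μ(stage m+1) + Δ_n(2) ≤ μ(stage m)`. Definitional unfolding (the `let`s ARE the `WildCones`
definitions, `run (m+1) = step (i m) (t m) (run m)`) onto `CharTwo.singleStepDrop_of_eq_two`.
OURS; NOT a statement of Hironaka's manuscript. [folklore] -/
theorem isolatedJacobianDrop_charTwo :
    ∀ p : ℕ, p.Prime → p = 2 → ∀ n : ℕ, 0 < n → ∀ (κ : Type) [Field κ] [CharP κ p] [PerfectField κ] (c₀ : (Fin n → ℕ) → κ) (i : ℕ → Fin n) (t : ℕ → Fin n → κ), let clean : ((Fin n → ℕ) → κ) → ((Fin n → ℕ) → κ) := fun c A => @ite κ (∀ j, p ∣ A j) (Classical.dec _) 0 (c A); let bl : Fin n → ((Fin n → ℕ) → κ) → ((Fin n → ℕ) → κ) := fun i c B => @ite κ (Finset.sum (Finset.univ.erase i) (fun j => B j) ≤ B i) (Classical.dec _) (c (Function.update B i (B i - Finset.sum (Finset.univ.erase i) (fun j => B j)))) 0; let ord : ((Fin n → ℕ) → κ) → ℕ := fun c => sInf {m : ℕ | ∃ A, c A ≠ 0 ∧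 m = Finset.sum Finset.univ (fun j => A j)}; let dv : Fin n → ℕ → ((Fin n → ℕ) → κ) → ((Fin n → ℕ) → κ) := fun i s c B => c (Function.update B i (B i + s)); let tr : Fin n → (Fin n → κ) → ℕ → ((Fin n → ℕ) → κ) → ((Fin n → ℕ) → κ) := fun i τ s c B => Finset.sum (Fintype.piFinset (fun _ : Fin n => Finset.range (B i + s + 1))) (fun D => @ite κ (D i = 0) (Classical.dec _) (c (B + D) * Finset.prod (Finset.univ.erase i) (fun j => ((Nat.choose (B j + D j) (B j) : ℕ) : κ) * τ j ^ (D j))) 0); let step : Fin n → (Fin n → κ) → ((Fin n → ℕ) → κ) → ((Fin n → ℕ) → κ) := fun i τ c => clean (tr i τ (@ite ℕ (p ≤ ord (clean c)) (Classical.dec _) p 0) (dv i (@ite ℕ (p ≤ ord (clean c)) (Classical.dec _) p 0) (bl i (clean c)))); let run : ((Fin n → ℕ) → κ) → (ℕ → Fin n) → (ℕ → Fin n → κ) → ℕ → ((Fin n → ℕ) → κ) := fun c₀ i t m => @Nat.rec (fun _ => (Fin n → ℕ) → κ) c₀ (fun m c => step (i m) (t m) c) m; let ser : ((Fin n → ℕ)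 → κ) → MvPowerSeries (Fin n) κ := fun c => show MvPowerSeries (Fin n) κ from fun A : Fin n →₀ ℕ => clean c ⇑A; let pd : Fin n → MvPowerSeries (Fin n) κ → MvPowerSeries (Fin n) κ := fun i f => show MvPowerSeries (Fin n) κ from fun A : Fin n →₀ ℕ => ((A i + 1 : ℕ) : κ) * f (A + Finsupp.single i 1); let jac : ((Fin n → ℕ) → κ) → Ideal (MvPowerSeries (Fin n) κ) := fun c => Ideal.span (Set.range (fun i => pd i (ser c))); let Isol : ((Fin n → ℕ) → κ) → Prop := fun c => Module.Finite κ (MvPowerSeries (Fin n) κ ⧸ jac c); let MultP : ((Fin n → ℕ) → κ) → Prop := fun c => (∃ A, clean c A ≠ 0) ∧ ∀ A, clean c A ≠ 0 → p ≤ Finset.sum Finset.univ (fun j => A j); let mu : ((Fin n → ℕ) → κ) → ℕ := fun c => Module.finrank κ (MvPowerSeries (Fin n) κ ⧸ jac c); let Δ : ℕ := ((p - 1) ^ n * (p + 1) + 1 - 2 * ((n + 1) % 2)) / p; ∀ m, Isol (run c₀ i t m) → MultP (run c₀ i t m) → Isol (run c₀ i t (m + 1)) → MultP (run c₀ i t (m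 + 1)) → mu (run c₀ i t (m + 1)) + Δ ≤ mu (run c₀ i t m) := by
  intro p _ hp n _ κ _ _ _ c₀ i t _ _ _ _ _ _ _ _ _ _ _ _ _ _ m k1 k2 k3 k4
  exact CharTwo.singleStepDrop_of_eq_two p hp n κ (run p n κ c₀ i t m) (i m) (t m) k1 k2 k3 k4

end Summit.ResolutionOfSingularities.ResolutionOfSingularities.Theorems.JacobianBudget

end
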